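import Mathlib
import Summits.NavierStokesRegularity.NavierStokesRegularity.Theorems.WakeRatchetTailRatchetPostFiringFrozenWake
import HarnessLib

/-!
# `WakeRatchet.TailRatchet` (stmt-NavierStokesRegularity-21808), door D4′ — the three forms of its analytic input
# COINCIDE: post-firing decay (D′) ⟺ bounded-delay simultaneous quiet times (QT) ⟺ frame energy (E₀)

Def-free support lemmas (MODEL lattice ODEs: the scalar dyadic member of Tao 2016 §1.2 / §4 in the renormalised
variables of §6.4; nothing here concerns the Navier–Stokes equations; stmt-21808 is neither proved nor refuted here and
no stub of skeleton d00b85951d7c is closed).  Same setting as `WakeRatchetTailRatchetPostFiringClock` /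
`…PostFiringFrozenWake` (hypotheses explicit): `W_n' = −W_n + ΛW_{n−1}² − Λ⁻¹W_nW_{n+1}` on `σ > A₀`, `0 ≤ W ≤ B` on
`σ ≥ A`, shells below `0` vanish, quiet start `W_n(A) = 0` (`n > 0`), level `c > 0` with `Λc ≤ 1`.

Door D4′ of the item's census closes stmt-21808 as REFUTED modulo ONE estimate on the renormalised one-shell dyadic
Cauchy blow-up (`WakeRatchetDyadicPostFiring.DyadicCauchyPostFiringBound`, in physical variables the bound (D); in the
variables above the POST-FIRING DECAY (D′) `W_n(σ₁) ≥ c, A ≤ σ₁ ≤ σ₂ ⟹ W_n(σ₂) ≤ D e^{−(σ₂−σ₁)}`).  Two other readings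
of the same debt circulate in the census: the LOCAL one (QT) «every firing is followed within log-time `L` by an instant
at which shells `0..n` are simultaneously `≤ η`, `4Λη ≤ 1`» (`postFiringDecay_of_quietTimes`: (QT) ⟹ (D′)), and the
frame-energy clause (E) of `WakeRatchetDyadicScalarEternal.DyadicPersistentFrames` for the frames recentred at the
first firings `s j` («`e^{2σ} W_j(σ + s_j)² ≤ P` for `σ ≥ σₑ`», which `persistentFrames_of_postFiringDecay` derives
from (D′)).  This file proves the two converses, so that NO re-bookkeeping of door D4′ can weaken its input:

* `quietTimes_of_postFiringDecay` — (D′) ⟹ (QT) with ANY level `η > 0` and delay `L = max(0, log(D/η))` (firing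
  order `exists_fired_below`: every shell `k ≤ n` has fired by the time shell `n` fires, then decays);
* `postFiringDecay_iff_quietTimes` — under the standing hypotheses, `(∃ D, (D′)) ↔ (∃ η L, 0 < η ∧ 4Λη ≤ 1 ∧ (QT))`;
* `frameEnergy_of_postFiringDecay` / `postFiringDecay_of_frameEnergy` / `postFiringDecay_iff_frameEnergy` — for
  first-firing log-times `s` (level reached, minimal), (D′) ⟺ the frame-energy clause at relative shell `0`
  («`e^{2σ} W_j(σ + s_j)² ≤ P` for `σ ≥ σₑ`, all `j`»); the direction (E₀) ⟹ (D′) uses only the uniform bound `B`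
  before `σₑ` and `√P` after it.

So the remaining analytic debt of door D4′ is ONE statement in three equivalent dresses; the equivalences are
elementary and hold at every fixed `Λ` (no uniformity in the scale ratio is involved).  HONEST FRAMING: elementary
real analysis on a MODEL lattice; neither (D′) nor (QT) nor (E₀) is proved here; rung 0.
-/

noncomputable section

set_option linter.dupNamespace false

namespace Summit.NavierStokesRegularity.NavierStokesRegularity.Theorems

namespace WakeRatchetDyadicPostFiring

open Set Filter Topology
open WakeRatchetFiringClock

variable {Λ : ℝ} {W : ℤ → ℝ → ℝ} {A₀ A B c D : ℝ}

/-! ## (D′) ⟹ (QT): quiet times from post-firing decay -/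

/-- **Quiet times from post-firing decay.**  Under quiet start, non-negativity, `Λc ≤ 1` and the post-firing decay
(D′) with constant `D`: for every level `η > 0`, every firing `W_n(σ₁) ≥ c` (`n ≥ 0`, `σ₁ ≥ A`) is followed, exactly
at `σ₀ = σ₁ + max(0, log(D/η))`, by an instant at which ALL shells `0 ≤ k ≤ n` are `≤ η` (each such shell has fired
at some `τ ≤ σ₁` by the firing order, and then `W_k(σ₀) ≤ D e^{−(σ₀−τ)} ≤ D e^{−log(D/η)} = η`).
[cite: Tao2016AveragedNS, §1.2 (dyadic model), §4 Lemma 4.1 (4.8), §6.4; elementary] -/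
theorem quietTimes_of_postFiringDecay (hΛ : 0 < Λ) (hA : A₀ < A) (hc : 0 < c) (hΛc : Λ * c ≤ 1)
    (hlaw : ∀ (n : ℤ) (σ : ℝ), A₀ < σ → HasDerivAt (W n)
      (-(W n σ) + Λ * W (n - 1) σ ^ 2 - Λ⁻¹ * W n σ * W (n + 1) σ) σ)
    (hnn : ∀ (n : ℤ) (σ : ℝ), A ≤ σ → 0 ≤ W n σ) (hstart : ∀ n : ℤ, 0 < n → W n A = 0)
    (hdec : ∀ (n : ℤ) (σ₁ σ₂ : ℝ), A ≤ σ₁ → σ₁ ≤ σ₂ → c ≤ W n σ₁ →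
      W n σ₂ ≤ D * Real.exp (-(σ₂ - σ₁)))
    {η : ℝ} (hη : 0 < η) :
    ∀ (n : ℕ) (σ₁ : ℝ), A ≤ σ₁ → c ≤ W n σ₁ →
      ∃ σ₀ : ℝ, σ₁ ≤ σ₀ ∧ σ₀ ≤ σ₁ + max 0 (Real.log (D / η)) ∧ ∀ k : ℕ, k ≤ n → W k σ₀ ≤ η := by
  intro n σ₁ hσ₁ hfire
  set L : ℝ := max 0 (Real.log (D / η)) with hL
  have hL0 : 0 ≤ L := le_max_left _ _
  refine ⟨σ₁ + L, by linarith, le_rfl, fun k hk => ?_⟩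
  -- shell `k ≤ n` has fired at some `τ ∈ [A, σ₁]`
  have hfire' : c ≤ W ((k + (n - k) : ℕ) : ℤ) σ₁ := by rwa [Nat.add_sub_cancel' hk]
  obtain ⟨τ, hτA, hτσ, hτc⟩ := exists_fired_below hΛ hA hc hΛc hlaw hnn hstart k (n - k) hσ₁ hfire'
  have hd := hdec (k : ℤ) τ (σ₁ + L) hτA (by linarith) hτc
  refine hd.trans ?_
  rcases le_or_gt D 0 with hD | hD
  · exact (mul_nonpos_of_nonpos_of_nonneg hD (Real.exp_pos _).le).trans hη.le
  · -- `D e^{-(σ₁+L-τ)} ≤ D e^{-L} ≤ D e^{-log(D/η)} = η`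
    have h1 : Real.exp (-(σ₁ + L - τ)) ≤ Real.exp (-Real.log (D / η)) :=
      Real.exp_le_exp.2 (by linarith [le_max_right 0 (Real.log (D / η))])
    have h2 : Real.exp (-Real.log (D / η)) = η / D := by
      rw [Real.exp_neg, Real.exp_log (div_pos hD hη), inv_div]
    calc D * Real.exp (-(σ₁ + L - τ)) ≤ D * Real.exp (-Real.log (D / η)) :=
        mul_le_mul_of_nonneg_left h1 hD.le
      _ = η := by rw [h2]; field_simp

/-- **(D′) ⟺ (QT).**  Under the standing hypotheses (law on `σ > A₀`, `0 ≤ W ≤ B` on `σ ≥ A`, shells below `0`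
vanish, quiet start, `0 < c`, `Λc ≤ 1`): the post-firing decay (D′) holds for SOME constant `D` if and only if
bounded-delay simultaneous quiet times (QT) hold for SOME level `η ∈ (0, 1/(4Λ)]` and SOME delay `L`
(`quietTimes_of_postFiringDecay` with `η = 1/(4Λ)`; `postFiringDecay_of_quietTimes` with `D = max(B,2η)e^{L}`).
[cite: Tao2016AveragedNS, §1.2, §4 Lemma 4.1 (4.8), §6.4; elementary] -/
theorem postFiringDecay_iff_quietTimes (hΛ : 0 < Λ) (hA : A₀ < A) (hc : 0 < c) (hΛc : Λ * c ≤ 1)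
    (hlaw : ∀ (n : ℤ) (σ : ℝ), A₀ < σ → HasDerivAt (W n)
      (-(W n σ) + Λ * W (n - 1) σ ^ 2 - Λ⁻¹ * W n σ * W (n + 1) σ) σ)
    (hnn : ∀ (n : ℤ) (σ : ℝ), A ≤ σ → 0 ≤ W n σ) (hB : ∀ (n : ℤ) (σ : ℝ), A ≤ σ → W n σ ≤ B)
    (hneg : ∀ n : ℤ, n < 0 → ∀ σ : ℝ, A ≤ σ → W n σ = 0) (hstart : ∀ n : ℤ, 0 < n → W n A = 0) :
    (∃ D : ℝ, ∀ (n : ℤ) (σ₁ σ₂ : ℝ), A ≤ σ₁ → σ₁ ≤ σ₂ → c ≤ W n σ₁ →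
        W n σ₂ ≤ D * Real.exp (-(σ₂ - σ₁))) ↔
      (∃ η L : ℝ, 0 < η ∧ 4 * Λ * η ≤ 1 ∧ ∀ (n : ℕ) (σ₁ : ℝ), A ≤ σ₁ → c ≤ W n σ₁ →
        ∃ σ₀ : ℝ, σ₁ ≤ σ₀ ∧ σ₀ ≤ σ₁ + L ∧ ∀ k : ℕ, k ≤ n → W k σ₀ ≤ η) := by
  constructor
  · rintro ⟨D, hdec⟩
    have hη : (0 : ℝ) < 1 / (4 * Λ) := by positivity
    refine ⟨1 / (4 * Λ), max 0 (Real.log (D / (1 / (4 * Λ)))), hη, le_of_eq (by field_simp), ?_⟩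
    exact quietTimes_of_postFiringDecay hΛ hA hc hΛc hlaw hnn hstart hdec hη
  · rintro ⟨η, L, hη, h4, hQT⟩
    exact ⟨max B (2 * η) * Real.exp L,
      postFiringDecay_of_quietTimes hΛ hA hlaw hnn hB hneg hη.le h4 hQT⟩

/-! ## (D′) ⟺ (E₀): the frame-energy clause at relative shell `0` -/

/-- **Frame energy from post-firing decay.**  If `s` marks log-times at which the level is reached (`A ≤ s j`,
`W_j(s_j) ≥ c`) and (D′) holds, then the frames recentred at `s` obey the energy clause at relative shell `0` with
`σₑ = 0`, `P = D²`: `e^{2σ} W_j(σ + s_j)² ≤ D²` for all `σ ≥ 0` and all `j`.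
[cite: Tao2016AveragedNS, §6.4 (renormalised energy `e^{2σ}W²`); elementary] -/
theorem frameEnergy_of_postFiringDecay (hnn : ∀ (n : ℤ) (σ : ℝ), A ≤ σ → 0 ≤ W n σ)
    (hdec : ∀ (n : ℤ) (σ₁ σ₂ : ℝ), A ≤ σ₁ → σ₁ ≤ σ₂ → c ≤ W n σ₁ →
      W n σ₂ ≤ D * Real.exp (-(σ₂ - σ₁)))
    {s : ℕ → ℝ} (hs1 : ∀ n : ℕ, A ≤ s n) (hs2 : ∀ n : ℕ, c ≤ W n (s n)) :
    ∀ (j : ℕ) (σ : ℝ), 0 ≤ σ → Real.exp (2 * σ) * W j (σ + s j) ^ 2 ≤ D ^ 2 := by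
  intro j σ hσ
  have h0 : 0 ≤ W (j : ℤ) (σ + s j) := hnn _ _ (by linarith [hs1 j])
  have hd : W (j : ℤ) (σ + s j) ≤ D * Real.exp (-(σ + s j - s j)) :=
    hdec (j : ℤ) (s j) (σ + s j) (hs1 j) (by linarith) (hs2 j)
  rw [add_sub_cancel_right] at hd
  have hD : 0 ≤ D * Real.exp (-σ) := h0.trans hd
  have hexp : Real.exp (2 * σ) * Real.exp (-σ) ^ 2 = 1 := by
    rw [← Real.exp_nat_mul, ← Real.exp_add]
    have e0 : (2 : ℝ) * σ + ((2 : ℕ) : ℝ) * -σ = 0 := by push_cast; ring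
    rw [e0, Real.exp_zero]
  calc Real.exp (2 * σ) * W (j : ℤ) (σ + s j) ^ 2
      ≤ Real.exp (2 * σ) * (D * Real.exp (-σ)) ^ 2 :=
        mul_le_mul_of_nonneg_left (pow_le_pow_left₀ h0 hd 2) (Real.exp_pos _).le
    _ = D ^ 2 * (Real.exp (2 * σ) * Real.exp (-σ) ^ 2) := by ring
    _ = D ^ 2 := by rw [hexp, mul_one]

/-- **Post-firing decay from frame energy.**  Let `0 ≤ W ≤ B` on `σ ≥ A`, shells below `0` vanish, and let `s`
be MINIMAL firing log-times (`A ≤ s j`; `W_j(σ) ≥ c`, `σ ≥ A` ⟹ `s j ≤ σ`).  If the frames recentred at `s` obey the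
energy clause at relative shell `0` — `e^{2σ} W_j(σ + s_j)² ≤ P` whenever `σ ≥ σₑ` and `σ > A − s_j` — then (D′)
holds with `D = max(√P, B e^{max(σₑ,1)})`: after a firing `W_n(σ₁) ≥ c` one has `s_n ≤ σ₁`, and at `σ₂ ≥ σ₁` either
`σ₂ − s_n ≥ max(σₑ,1)` (then `e^{σ₂−s_n}W_n(σ₂) ≤ √P`) or not (then `W_n(σ₂) ≤ B ≤ Be^{max(σₑ,1)}e^{−(σ₂−s_n)}`).
[cite: Tao2016AveragedNS, §6.4 (renormalised energy `e^{2σ}W²`); elementary] -/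
theorem postFiringDecay_of_frameEnergy (hnn : ∀ (n : ℤ) (σ : ℝ), A ≤ σ → 0 ≤ W n σ)
    (hB : ∀ (n : ℤ) (σ : ℝ), A ≤ σ → W n σ ≤ B) (hneg : ∀ n : ℤ, n < 0 → ∀ σ : ℝ, A ≤ σ → W n σ = 0)
    {s : ℕ → ℝ} (hs1 : ∀ n : ℕ, A ≤ s n)
    (hs3 : ∀ (n : ℕ) (σ : ℝ), A ≤ σ → c ≤ W (n : ℤ) σ → s n ≤ σ)
    {σe P : ℝ}
    (hE : ∀ (j : ℕ) (σ : ℝ), σe ≤ σ → A - s j < σ → Real.exp (2 * σ) * W j (σ + s j) ^ 2 ≤ P) :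
    ∀ (n : ℤ) (σ₁ σ₂ : ℝ), A ≤ σ₁ → σ₁ ≤ σ₂ → c ≤ W n σ₁ →
      W n σ₂ ≤ max (Real.sqrt P) (B * Real.exp (max σe 1)) * Real.exp (-(σ₂ - σ₁)) := by
  intro n σ₁ σ₂ hσ₁ h12 hfire
  set σe' : ℝ := max σe 1 with hσe'
  set M : ℝ := max (Real.sqrt P) (B * Real.exp σe') with hM
  have hM0 : 0 ≤ M := (Real.sqrt_nonneg P).trans (le_max_left _ _)
  have hσ₂ : A ≤ σ₂ := hσ₁.trans h12
  rcases lt_or_ge n 0 with hn | hn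
  · rw [hneg n hn σ₂ hσ₂]
    positivity
  · obtain ⟨j, rfl⟩ : ∃ j : ℕ, (j : ℤ) = n := ⟨n.toNat, Int.toNat_of_nonneg hn⟩
    have hsj : s j ≤ σ₁ := hs3 j σ₁ hσ₁ hfire
    have hB0 : 0 ≤ B := (hnn (j : ℤ) σ₁ hσ₁).trans (hB (j : ℤ) σ₁ hσ₁)
    have hW0 : 0 ≤ W (j : ℤ) σ₂ := hnn _ _ hσ₂
    -- `x = σ₂ - s j ≥ σ₂ - σ₁ ≥ 0`
    have hx : σ₂ - σ₁ ≤ σ₂ - s j := by linarith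
    have hex : Real.exp (-(σ₂ - s j)) ≤ Real.exp (-(σ₂ - σ₁)) := Real.exp_le_exp.2 (by linarith)
    rcases le_or_gt σe' (σ₂ - s j) with hcase | hcase
    · -- late: the energy clause
      have h1 : σe ≤ σ₂ - s j := (le_max_left _ _).trans hcase
      have h2 : A - s j < σ₂ - s j := by
        have : (1 : ℝ) ≤ σ₂ - s j := (le_max_right _ _).trans hcase
        linarith [hs1 j]
      have hP := hE j (σ₂ - s j) h1 h2
      rw [sub_add_cancel] at hP
      have hsq : (Real.exp (σ₂ - s j) * W (j : ℤ) σ₂) ^ 2 ≤ P := by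
        have e2 : Real.exp (σ₂ - s j) ^ 2 = Real.exp (2 * (σ₂ - s j)) := by
          rw [← Real.exp_nat_mul]; norm_num
        rw [mul_pow, e2]; exact hP
      have habs := Real.abs_le_sqrt hsq
      rw [abs_of_nonneg (mul_nonneg (Real.exp_pos _).le hW0)] at habs
      -- `W ≤ √P e^{-(σ₂ - s j)}`
      have hW : W (j : ℤ) σ₂ ≤ Real.sqrt P * Real.exp (-(σ₂ - s j)) := by
        have hpos : 0 < Real.exp (σ₂ - s j) := Real.exp_pos _
        rw [Real.exp_neg, ← div_eq_mul_inv, le_div_iff₀ hpos, mul_comm]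
        exact habs
      calc W (j : ℤ) σ₂ ≤ Real.sqrt P * Real.exp (-(σ₂ - s j)) := hW
        _ ≤ M * Real.exp (-(σ₂ - s j)) :=
            mul_le_mul_of_nonneg_right (le_max_left _ _) (Real.exp_pos _).le
        _ ≤ M * Real.exp (-(σ₂ - σ₁)) := mul_le_mul_of_nonneg_left hex hM0
    · -- early: the uniform bound
      have h1 : 1 ≤ Real.exp σe' * Real.exp (-(σ₂ - s j)) := by
        rw [← Real.exp_add]
        exact Real.one_le_exp (by linarith)
      calc W (j : ℤ) σ₂ ≤ B := hB _ _ hσ₂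
        _ ≤ B * (Real.exp σe' * Real.exp (-(σ₂ - s j))) := le_mul_of_one_le_right hB0 h1
        _ = B * Real.exp σe' * Real.exp (-(σ₂ - s j)) := by ring
        _ ≤ M * Real.exp (-(σ₂ - s j)) :=
            mul_le_mul_of_nonneg_right (le_max_right _ _) (Real.exp_pos _).le
        _ ≤ M * Real.exp (-(σ₂ - σ₁)) := mul_le_mul_of_nonneg_left hex hM0

/-- **(D′) ⟺ (E₀).**  With `0 ≤ W ≤ B` on `σ ≥ A`, shells below `0` vanishing, and first-firing log-times `s`
(`A ≤ s j`, `W_j(s_j) ≥ c`, minimal): the post-firing decay (D′) holds for SOME `D` if and only if the frames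
recentred at `s` obey the energy clause at relative shell `0` for SOME `σₑ, P` — the clause (E) (at `n = 0`) of
`WakeRatchetDyadicScalarEternal.DyadicPersistentFrames` for these frames is not weaker than (D′) itself.
[cite: Tao2016AveragedNS, §6.4 (renormalised energy `e^{2σ}W²`); elementary] -/
theorem postFiringDecay_iff_frameEnergy (hnn : ∀ (n : ℤ) (σ : ℝ), A ≤ σ → 0 ≤ W n σ)
    (hB : ∀ (n : ℤ) (σ : ℝ), A ≤ σ → W n σ ≤ B) (hneg : ∀ n : ℤ, n < 0 → ∀ σ : ℝ, A ≤ σ → W n σ = 0)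
    {s : ℕ → ℝ} (hs1 : ∀ n : ℕ, A ≤ s n) (hs2 : ∀ n : ℕ, c ≤ W n (s n))
    (hs3 : ∀ (n : ℕ) (σ : ℝ), A ≤ σ → c ≤ W (n : ℤ) σ → s n ≤ σ) :
    (∃ D : ℝ, ∀ (n : ℤ) (σ₁ σ₂ : ℝ), A ≤ σ₁ → σ₁ ≤ σ₂ → c ≤ W n σ₁ →
        W n σ₂ ≤ D * Real.exp (-(σ₂ - σ₁))) ↔
      (∃ σe P : ℝ, ∀ (j : ℕ) (σ : ℝ), σe ≤ σ → A - s j < σ →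
        Real.exp (2 * σ) * W j (σ + s j) ^ 2 ≤ P) := by
  constructor
  · rintro ⟨D, hdec⟩
    exact ⟨0, D ^ 2, fun j σ hσ _ => frameEnergy_of_postFiringDecay hnn hdec hs1 hs2 j σ hσ⟩
  · rintro ⟨σe, P, hE⟩
    exact ⟨_, postFiringDecay_of_frameEnergy hnn hB hneg hs1 hs3 hE⟩

end WakeRatchetDyadicPostFiring

end Summit.NavierStokesRegularity.NavierStokesRegularity.Theorems

end
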